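import Mathlib
import Summits.ValiantsHypothesis.ValiantsHypothesis.Theorems.RigidityForcesSymmetryRankRigidMinimalReprLaplaceFiveSeparatedCaptureLinesK1
import Summits.ValiantsHypothesis.ValiantsHypothesis.Theorems.RigidityForcesSymmetryRankRigidMinimalReprLaplaceFiveSeparatedCaptureLineInTwoPlanes

/-!
# ValiantsHypothesis / RigidityForcesSymmetry — crux `LaplaceOptimalFive` (stmt-ValiantsHypothesis-24813), young-shadow K1:
# **K1 ON `K₃ ⊔ K₂` FOR A NESTED SHORT SPAN** (a triangle short span of dimension `≤ 1` inside the other two, of dimension `≤ 2`)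

K1 consumer of ✓ `captureIneqSym_of_line_in_two_planes` (N1, the nested-line profile `(1,2,2)♭` of `CaptureIneqSym`) through the
local bridge ✓ `sideSym_K32canon_of_captureAt` (`…K1Bridge.lean`), in the shape of ✓ `sideSym_K32canon_lines / _two_lines /
_disjoint_pair(_four)`: a side-symmetric split decomposition of `P₅` on `{01, 02, 12, 34}` one of whose triangle short spans has
dimension `≤ 1` and lies in the other two (of dimension `≤ 2`) has Laplace weight `≥ 5! = 120` — in all three placements of the
nested span (rôle symmetry ✓ `contractZ_mem_L3_swap23/13`).  First the submodule-currency form of N1 (the short span of dimension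
`≤ 1` is `⊥` — ✓ `captureIneqSym_of_one_bot` — or a line `ℂu`, ✓ `eq_bot_or_line_of_finrank_le_one`).

* ★ `captureIneqSym_of_nested_line` — `CaptureIneqSym` for `finrank U₀₁ ≤ 1`, `U₀₁ ≤ U₀₂ ⊓ U₁₂`, `finrank U₀₂, U₁₂ ≤ 2`.
* ★★ `sideSym_K32canon_nested_line` (nested span on `{0,1}`);  ★ `…_nested_line02`, ★ `…_nested_line12` — the other two cuts.

Honest framing.  A SUB-CASE of K1 on `K₃ ⊔ K₂`; the profile `(2,2,2)♭` (not all equal), spans of dimension `≥ 3`, K1 on `K₃ ⊔ K₂`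
in general, `CaptureIneqSym`, S2′, `LaplaceOptimalFive` (OPEN · CONTESTED 72/120), `RankRigidMinimalRepr`, `VP ≠ VNP` are NOT
proved.  No definitions, no `sorry`.
-/

set_option linter.dupNamespace false
set_option autoImplicit false

namespace Summit.ValiantsHypothesis.ValiantsHypothesis.Theorems.RigidityForcesSymmetryRankRigidMinimalRepr

namespace LaplaceFiveSeparatedCapture

open Finset LaplaceFiveSectorSplit

/-- ★ **`CaptureIneqSym` FOR A NESTED SHORT SPAN, submodule currency**: `finrank U₀₁ ≤ 1`, `U₀₁ ≤ U₀₂`, `U₀₁ ≤ U₁₂`,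
`finrank U₀₂, finrank U₁₂ ≤ 2` (all symmetric) ⇒ the capture inequality.  `U₀₁ = ⊥`: ✓ `captureIneqSym_of_one_bot`;
`U₀₁ = ℂu`: ✓ `captureIneqSym_of_line_in_two_planes` (N1). [folklore] -/
theorem captureIneqSym_of_nested_line (U01 U02 U12 W : Submodule ℂ (Fin 5 → Fin 5 → ℂ))
    (h01 : ∀ x ∈ U01, ∀ p q : Fin 5, x p q = x q p) (h02 : ∀ x ∈ U02, ∀ p q : Fin 5, x p q = x q p)
    (h12 : ∀ x ∈ U12, ∀ p q : Fin 5, x p q = x q p) (hd01 : Module.finrank ℂ U01 ≤ 1)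
    (hle02 : U01 ≤ U02) (hle12 : U01 ≤ U12) (hd02 : Module.finrank ℂ U02 ≤ 2) (hd12 : Module.finrank ℂ U12 ≤ 2)
    (hWs : ∀ μ ∈ W, ∀ s t : Fin 5, μ s t = μ t s) (hWd : ∀ μ ∈ W, ∀ s : Fin 5, μ s s = 0)
    (hWc : ∀ μ ∈ W, contractZ μ ∈ L3 U01 U02 U12) :
    Module.finrank ℂ W ≤ Module.finrank ℂ U01 + Module.finrank ℂ U02 + Module.finrank ℂ U12 := by
  rcases eq_bot_or_line_of_finrank_le_one U01 hd01 with hbot | ⟨u, hu0, huU, hUeq⟩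
  · exact captureIneqSym_of_one_bot U01 U02 U12 W h01 h02 h12 (Or.inl hbot) hWs hWd hWc
  · have hu : ∀ p q, u p q = u q p := h01 u huU
    subst hUeq
    exact captureIneqSym_of_line_in_two_planes u hu hu0 U02 U12 W h02 h12 hd02 hd12
      (hle02 (Submodule.mem_span_singleton_self u)) (hle12 (Submodule.mem_span_singleton_self u)) hWs hWd hWc

/-- ★★ **K1 ON `K₃ ⊔ K₂ = {01, 02, 12, 34}` FOR A NESTED SHORT SPAN ON `{0,1}`**: the short span on `{0,1}` has dimension `≤ 1`
and lies in both short spans on `{0,2}`, `{1,2}`, which have dimension `≤ 2` ⇒ Laplace weight `≥ 5! = 120`. [folklore] -/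
theorem sideSym_K32canon_nested_line {N : ℕ} (T : Finset (Fin N)) (S : Fin N → Finset (Fin 5))
    (u w : Fin N → (Fin 5 → Fin 5) → ℂ) (hdec : IsSplitDecomposition T S u w) (hsym : SideSymmetric T S u w)
    (hC : ∀ t ∈ T, S t = ({0, 1} : Finset (Fin 5)) ∨ S t = ({0, 2} : Finset (Fin 5)) ∨
      S t = ({1, 2} : Finset (Fin 5)) ∨ S t = ({3, 4} : Finset (Fin 5)))
    (h01 : Module.finrank ℂ (shortSpan T S u 0 1) ≤ 1)
    (hle02 : shortSpan T S u 0 1 ≤ shortSpan T S u 0 2) (hle12 : shortSpan T S u 0 1 ≤ shortSpan T S u 1 2)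
    (h02 : Module.finrank ℂ (shortSpan T S u 0 2) ≤ 2) (h12 : Module.finrank ℂ (shortSpan T S u 1 2) ≤ 2) :
    Nat.factorial 5 ≤ laplaceWeight T S :=
  sideSym_K32canon_of_captureAt T S u w hdec hsym hC fun hs01 hs02 hs12 W hWs hWd hWc =>
    captureIneqSym_of_nested_line _ _ _ W hs01 hs02 hs12 h01 hle02 hle12 h02 h12 hWs hWd hWc

/-- ★ **Nested short span on `{0,2}`** (dimension `≤ 1`, inside the short spans on `{0,1}`, `{1,2}` of dimension `≤ 2`), by the rôle
symmetries ✓ `contractZ_mem_L3_swap23` and ✓ `contractZ_mem_L3_swap13`. [folklore] -/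
theorem sideSym_K32canon_nested_line02 {N : ℕ} (T : Finset (Fin N)) (S : Fin N → Finset (Fin 5))
    (u w : Fin N → (Fin 5 → Fin 5) → ℂ) (hdec : IsSplitDecomposition T S u w) (hsym : SideSymmetric T S u w)
    (hC : ∀ t ∈ T, S t = ({0, 1} : Finset (Fin 5)) ∨ S t = ({0, 2} : Finset (Fin 5)) ∨
      S t = ({1, 2} : Finset (Fin 5)) ∨ S t = ({3, 4} : Finset (Fin 5)))
    (h02 : Module.finrank ℂ (shortSpan T S u 0 2) ≤ 1)
    (hle01 : shortSpan T S u 0 2 ≤ shortSpan T S u 0 1) (hle12 : shortSpan T S u 0 2 ≤ shortSpan T S u 1 2)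
    (h01 : Module.finrank ℂ (shortSpan T S u 0 1) ≤ 2) (h12 : Module.finrank ℂ (shortSpan T S u 1 2) ≤ 2) :
    Nat.factorial 5 ≤ laplaceWeight T S := by
  refine sideSym_K32canon_of_captureAt T S u w hdec hsym hC fun hs01 hs02 hs12 W hWs hWd hWc => ?_
  have hWc' : ∀ μ ∈ W, contractZ μ ∈ L3 (shortSpan T S u 0 2) (shortSpan T S u 1 2) (shortSpan T S u 0 1) :=
    fun μ hμ => contractZ_mem_L3_swap13 _ _ _ hs01 hs12 hs02 μ (contractZ_mem_L3_swap23 _ _ _ hs01 μ (hWc μ hμ))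
  have h := captureIneqSym_of_nested_line _ _ _ W hs02 hs12 hs01 h02 hle12 hle01 h12 h01 hWs hWd hWc'
  omega

/-- ★ **Nested short span on `{1,2}`** (dimension `≤ 1`, inside the short spans on `{0,1}`, `{0,2}` of dimension `≤ 2`), by the rôle
symmetry ✓ `contractZ_mem_L3_swap13`. [folklore] -/
theorem sideSym_K32canon_nested_line12 {N : ℕ} (T : Finset (Fin N)) (S : Fin N → Finset (Fin 5))
    (u w : Fin N → (Fin 5 → Fin 5) → ℂ) (hdec : IsSplitDecomposition T S u w) (hsym : SideSymmetric T S u w)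
    (hC : ∀ t ∈ T, S t = ({0, 1} : Finset (Fin 5)) ∨ S t = ({0, 2} : Finset (Fin 5)) ∨
      S t = ({1, 2} : Finset (Fin 5)) ∨ S t = ({3, 4} : Finset (Fin 5)))
    (h12 : Module.finrank ℂ (shortSpan T S u 1 2) ≤ 1)
    (hle01 : shortSpan T S u 1 2 ≤ shortSpan T S u 0 1) (hle02 : shortSpan T S u 1 2 ≤ shortSpan T S u 0 2)
    (h01 : Module.finrank ℂ (shortSpan T S u 0 1) ≤ 2) (h02 : Module.finrank ℂ (shortSpan T S u 0 2) ≤ 2) :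
    Nat.factorial 5 ≤ laplaceWeight T S := by
  refine sideSym_K32canon_of_captureAt T S u w hdec hsym hC fun hs01 hs02 hs12 W hWs hWd hWc => ?_
  have hWc' : ∀ μ ∈ W, contractZ μ ∈ L3 (shortSpan T S u 1 2) (shortSpan T S u 0 2) (shortSpan T S u 0 1) :=
    fun μ hμ => contractZ_mem_L3_swap13 _ _ _ hs01 hs02 hs12 μ (hWc μ hμ)
  have h := captureIneqSym_of_nested_line _ _ _ W hs12 hs02 hs01 h12 hle02 hle01 h02 h01 hWs hWd hWc'
  omega

end LaplaceFiveSeparatedCapture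

end Summit.ValiantsHypothesis.ValiantsHypothesis.Theorems.RigidityForcesSymmetryRankRigidMinimalRepr
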